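import Summits.AtomisticToContinuum.HydrodynamicLimit.Theses.TwoClocks
import Summits.AtomisticToContinuum.HydrodynamicLimit.Theses.OneFlightGossipEngine
import Summits.AtomisticToContinuum.HydrodynamicLimit.Theses.JParityClosure
import Summits.AtomisticToContinuum.HydrodynamicLimit.Theorems.OneFlightGossipEngineCollisionActivityTailsActivityDomination
import Summits.AtomisticToContinuum.HydrodynamicLimit.Theorems.OneFlightGossipEngineCollisionActivityTailsEndpointKinematics
import Summits.AtomisticToContinuum.HydrodynamicLimit.Theorems.OneFlightGossipEngineCollisionActivityTailsNearFieldKineticMeasurable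
import Summits.AtomisticToContinuum.HydrodynamicLimit.Theorems.OneFlightGossipEngineCollisionActivityTailsNearFieldKineticTailsPathwise
import Summits.AtomisticToContinuum.HydrodynamicLimit.Theorems.OneFlightGossipEngineCollisionActivityTailsNearFieldKineticTails
import Summits.AtomisticToContinuum.HydrodynamicLimit.Theorems.OneFlightGossipEngineCollisionActivityTailsCrowdedActivityMeasurable
import Summits.AtomisticToContinuum.HydrodynamicLimit.Theorems.OneFlightGossipEngineCollisionActivityTailsMeanEnergyBound
import Summits.AtomisticToContinuum.HydrodynamicLimit.Theorems.OneFlightGossipEngineCollisionActivityTailsEndpointTails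
import Summits.AtomisticToContinuum.HydrodynamicLimit.Theorems.JParityClosureKineticEnergyTailsApriori
import HarnessLib

/-!
# Skeleton of line `SketchK1` for the crux `CollisionActivityTails` (stmt-AtomisticToContinuum-13734)

Crux decl: `Summit.AtomisticToContinuum.HydrodynamicLimit.Theses.TwoClocks.CollisionActivityTails` (the registered
crux decl) ≡ `…Theses.OneFlightGossipEngine.CollisionActivityTails` (the two route files carry byte-identical bodies;
the composition concludes BOTH by name: `CollisionActivityTails_proof` / `CollisionActivityTails_of`).

Lead prover-line-stmt-AtomisticToContinuum-13734-c3-0 (cycle 4; continuation of leads …-13734-0, -1, -c1-0, -c2-0). This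
file is the line's COMPOSITION over the vocabulary LANDED in cycles 1–3
(`Theorems/OneFlightGossipEngineCollisionActivityTails{ActivityDomination p94309, EndpointKinematics p86808,
MeanEnergyBound p88348, EndpointTails p89060, NearFieldKineticMeasurable p90029, NearFieldKineticTailsStatics p102147,
NearFieldKineticTailsPathwise p105299, NearFieldKineticTails p106773, CfgCollisionSums p109610,
CrowdedActivityMeasurable p110232, ActMeasurable p115117}.lean`); every landed stub is discharged BY IMPORT, and the ONLY
`sorry`s left (cycle 4 re-merge) are the two TAIL-SHAPED residuals `stub_nearFieldKineticTails` (B′) and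
`stub_crowdedCollisionTails` (A′) — the statements PROMOTE.md v3 proposes as items; their cycle-2/3 splits into
13087 + `NearFieldFractionLLN` and `CrowdedActivityUI` + `CrowdedFractionLLN` remain in the file as proved reductions
(`stub_nearFieldReduction`, `crowdedCollisionTails_of`):

  `ActivityDomination ∧ EndpointTails ∧ NearFieldKineticTails ∧ CrowdedCollisionTails ⟹ CollisionActivityTails`.

Mechanism. Pathwise on the good set `a_i ≤ F¹_i + C (F²_i + Fcr_i)` (`stub_activityDomination`, landed):
`F¹` endpoint near-field relative momentum, `F²` window-averaged near-field relative kinetic energy, `Fcr` crowded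
collisional activity near `i`. Tail algebra (`tailFn_le_three_sum`): with `C' = max C 1`,
`𝟙{a > V} a ≤ 3 C' Σ_m 𝟙{F^m > V/(3C')} F^m`. Hence the crux's `L¹` tail is at most `3C'` times the sum of the
three tails at level `V/(3C')`; the endpoint tail is closed (`stub_endpointTails`: Chebyshev + packing + energy
conservation + Gaussian marginal), the other two are the line's OPEN stubs, stated in the crux's own frame and
quantifier shape. Quantifier bookkeeping: `σ₀ = min`, `V₀ = 3C' max(V₀², V₀³)`, `τ₀ = max`, `N₀ = max`; the
`lintegral` of the sum splits because two of the three tail sums are a.e.-measurable (`lintegral_add_left'`).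

Stubs (registered on the crux item; `sorry` only in the OPEN ones):
* `stub_activityDomination : ActivityDomination` — LANDED (import, p94309).
* `stub_endpointKinematics : EndpointKinematics` — LANDED (import, p86808).
* `stub_meanEnergyBound : MeanEnergyBound` — LANDED (p88348; 20-line proof repeated here over this file's vocabulary).
* `stub_endpointTails : EndpointKinematics → MeanEnergyBound → EndpointTails` — LANDED (p89060; same remark).
* `stub_nearFieldKineticTails : NearFieldKineticTails` — OPEN (B′). Optional split: `stub_nearFieldReduction` (LANDED p106773,
  import): `KineticEnergyTails` (item 13087; in-route from the binder 9235) → `NearFieldFractionLLN` (§1c) → stub 5, with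
  ingredients `stub_nearFieldStatics` (p102147) and `stub_nearFieldPathwise` (p105299), imports.
* `stub_crowdedCollisionTails : CrowdedCollisionTails` — OPEN (A′). Optional split: `crowdedCollisionTails_of` (proved here, using
  the landed measurability p110232): `CrowdedActivityUI` (§1b, pure UI) → `CrowdedFractionLLN` (§1b) → stub 6.
-/

noncomputable section

open MeasureTheory Set Filter Topology
open scoped ENNReal

namespace Summit.AtomisticToContinuum.HydrodynamicLimit.Theorems.CollisionActivityTails

open Literature.MathematicalPhysics.KineticTheory Literature.Analysis.FluidPDE
open Summit.AtomisticToContinuum.HydrodynamicLimit.Theorems.CollisionActivityTailsActivityDomination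
open Summit.AtomisticToContinuum.HydrodynamicLimit.Theorems.CollisionActivityTailsNearFieldKineticTails (tailFn)
open Summit.AtomisticToContinuum.HydrodynamicLimit.Theses.JParityClosure (KineticEnergyTails)

/-! ## §1 Statements of the stubs (vocabulary = the landed `…ActivityDomination` file + `tailFn`) -/

/-- **ENDPOINT KINEMATICS** (stub 2, landed): `Σ_i (F¹_i)² ≤ K (σ/τ)² E(z)` on the good set, `0 < σ ≤ 1/8`. -/
def EndpointKinematics : Prop :=
  ∃ K : ℝ, 0 < K ∧ ∀ (σ : ℝ), 0 < σ → σ ≤ 1 / 8 → ∀ (N : ℕ) (Φ : Flow σ N) (τ : ℝ), 0 < τ →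
    ∀ (s : ℝ), ∀ z ∈ Φ.good,
      ∑ i : Fin (N + 1), (endpointTerm Φ τ s i z) ^ 2 ≤ K * (σ / τ) ^ 2 * configEnergy z

/-- **MEAN ENERGY BOUND** (stub 3, landed): `∫ E dλ_N ≤ e₀ (N+1)` under the local Gibbs law, `σ ≤ 1/2`. -/
def MeanEnergyBound : Prop :=
  ∀ (a₀ θ₀ : T3 → ℝ) (u₀ : T3 → V3), Continuous a₀ → Continuous θ₀ → Continuous u₀ →
    (∀ x, 0 < a₀ x) → (∀ x, 0 < θ₀ x) → ∃ e₀ : ℝ, 0 < e₀ ∧ ∀ (σ : ℝ), 0 < σ → σ ≤ 1 / 2 →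
    ∀ (N : ℕ) (Φ : Flow σ N),
      ∫⁻ z, ENNReal.ofReal (configEnergy z) ∂(localGibbsLaw σ a₀ u₀ θ₀ N Φ) ≤
        ENNReal.ofReal (e₀ * ((N : ℝ) + 1))

/-- **ENDPOINT TAILS** (stub 4, landed): the `L¹` tail of `F¹` above any `V > 0` is `≤ ε` for `τ ≥ τ₀(V, ε)`,
uniformly in `N`, the flow and the window start; with the measurability of the tail sum. -/
def EndpointTails : Prop :=
  ∀ (a₀ θ₀ : T3 → ℝ) (u₀ : T3 → V3), Continuous a₀ → Continuous θ₀ → Continuous u₀ →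
    (∀ x, 0 < a₀ x) → (∀ x, 0 < θ₀ x) → ∃ σ₀ : ℝ, 0 < σ₀ ∧ ∀ σ : ℝ, 0 < σ → σ < σ₀ →
    ∀ V : ℝ, 0 < V → ∀ ε : ℝ, 0 < ε → ∃ τ₀ : ℝ, 0 < τ₀ ∧ ∀ τ : ℝ, τ₀ ≤ τ →
    ∀ (N : ℕ) (Φ : Flow σ N) (s : ℝ),
      AEMeasurable (fun z => ∑ i : Fin (N + 1), tailFn V (endpointTerm Φ τ s i z))
          (localGibbsLaw σ a₀ u₀ θ₀ N Φ) ∧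
      ∫⁻ z, ENNReal.ofReal (((N : ℝ) + 1)⁻¹ * ∑ i : Fin (N + 1), tailFn V (endpointTerm Φ τ s i z))
        ∂(localGibbsLaw σ a₀ u₀ θ₀ N Φ) ≤ ENNReal.ofReal ε

/-- **NEAR-FIELD KINETIC TAILS** (stub 5; OPEN — card `one-flight-thinning-tails`). In the crux's own frame and
shape: the `L¹` tail of the window-averaged near-field relative kinetic energy `F²_i` above `V ≥ V₀` vanishes as
`τ → ∞` after `N → ∞`, uniformly in `s ≤ t < T`. Mechanism expected: hits of the co-moving `2ε`-ball by flights
form a thinned renewal stream with mean `∝ σ²τ` visits, each of weight `O(σ√θ/τ)` — an `LLN` in `τ`; fast tagged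
spheres thermalise in `o(w)`. Includes the measurability of the tail sum (landed for all data, p90029). -/
def NearFieldKineticTails : Prop :=
  ∀ (a₀ θ₀ : T3 → ℝ) (u₀ : T3 → V3), Continuous a₀ → Continuous θ₀ → Continuous u₀ →
    (∀ x, 0 < a₀ x) → (∀ x, 0 < θ₀ x) → ∃ σ₀ : ℝ, 0 < σ₀ ∧ ∀ σ : ℝ, 0 < σ → σ < σ₀ →
    ∀ (T : ℝ) (ρ θ : ℝ → T3 → ℝ) (u : ℝ → T3 → V3), IsHardSphereEulerSolution σ T ρ u θ →
    ∀ Φ : (N : ℕ) → Flow σ N,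
    TendstoHydroFieldsAt (fun N => localGibbsLaw σ a₀ u₀ θ₀ N (Φ N)) Φ ρ u θ 0 →
    ∀ t ∈ Set.Ico 0 T, ∃ V₀ : ℝ, 0 < V₀ ∧ ∀ V : ℝ, V₀ ≤ V → ∀ ε : ℝ, 0 < ε →
    ∃ τ₀ : ℝ, 0 < τ₀ ∧ ∀ τ : ℝ, τ₀ ≤ τ → ∃ N₀ : ℕ, ∀ N : ℕ, N₀ ≤ N → ∀ s ∈ Set.Icc 0 t,
      AEMeasurable (fun z => ∑ i : Fin (N + 1), tailFn V (nearFieldKinetic (Φ N) τ s i z))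
          (localGibbsLaw σ a₀ u₀ θ₀ N (Φ N)) ∧
      ∫⁻ z, ENNReal.ofReal (((N : ℝ) + 1)⁻¹ * ∑ i : Fin (N + 1), tailFn V (nearFieldKinetic (Φ N) τ s i z))
        ∂(localGibbsLaw σ a₀ u₀ θ₀ N (Φ N)) ≤ ENNReal.ofReal ε

/-- **CROWDED COLLISION TAILS** (stub 6; OPEN — card `contact-pole-budget-nmc` with card 1's droplet law). In the
crux's own frame and shape: the `L¹` tail of the crowded collisional activity `Fcr_i` above `V ≥ V₀` vanishes as
`τ → ∞` after `N → ∞`, uniformly in `s ≤ t < T`. Content: under the true pre-shock law, collisions occurring while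
`≥ 3` centres crowd a `3ε`-ball carry an asymptotically negligible activity-weighted fraction in mean — no long-lived
caging / mesoscopic condensation (co-moving: translating platoons included) of a positive activity-weighted
fraction. No measurability conjunct (the composition needs a.e.-measurability of two of the three tail sums only). -/
def CrowdedCollisionTails : Prop :=
  ∀ (a₀ θ₀ : T3 → ℝ) (u₀ : T3 → V3), Continuous a₀ → Continuous θ₀ → Continuous u₀ →
    (∀ x, 0 < a₀ x) → (∀ x, 0 < θ₀ x) → ∃ σ₀ : ℝ, 0 < σ₀ ∧ ∀ σ : ℝ, 0 < σ → σ < σ₀ →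
    ∀ (T : ℝ) (ρ θ : ℝ → T3 → ℝ) (u : ℝ → T3 → V3), IsHardSphereEulerSolution σ T ρ u θ →
    ∀ Φ : (N : ℕ) → Flow σ N,
    TendstoHydroFieldsAt (fun N => localGibbsLaw σ a₀ u₀ θ₀ N (Φ N)) Φ ρ u θ 0 →
    ∀ t ∈ Set.Ico 0 T, ∃ V₀ : ℝ, 0 < V₀ ∧ ∀ V : ℝ, V₀ ≤ V → ∀ ε : ℝ, 0 < ε →
    ∃ τ₀ : ℝ, 0 < τ₀ ∧ ∀ τ : ℝ, τ₀ ≤ τ → ∃ N₀ : ℕ, ∀ N : ℕ, N₀ ≤ N → ∀ s ∈ Set.Icc 0 t,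
      ∫⁻ z, ENNReal.ofReal (((N : ℝ) + 1)⁻¹ * ∑ i : Fin (N + 1), tailFn V (crowdedActivity (Φ N) τ s i z))
        ∂(localGibbsLaw σ a₀ u₀ θ₀ N (Φ N)) ≤ ENNReal.ofReal ε

/-! ### §1b Split of stub 6 (cycle 2 reshape): `L¹` tail = UNIFORM INTEGRABILITY × IN-PROBABILITY LLN

`𝟙{V < y} y ≤ 𝟙{M < y} y + M⁺ 𝟙{V < y}` (`tailFn_le_tailFn_add_mul_fracFn`): the crux-shaped `L¹` tail of `Fcr`
follows from (i) the UNIFORM INTEGRABILITY of `Fcr` under the true law (UI shape `∀ ε ∃ M`: a-priori-estimate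
territory — a second-moment bound on `Fcr` would give it; open, like the quadratic-velocity UI item
stmt-AtomisticToContinuum-13087) and (ii) the IN-PROBABILITY law of large numbers for the crowded activity of a
uniformly chosen tagged sphere (crux shape, bounded integrand `≤ 1`: the FRACTION of spheres with `Fcr_i > V`
vanishes in mean — the line's genuine dynamical residual); the `lintegral` (an inner integral) is split with the
a.e.-measurability of the first summand, LANDED for all data (p110232 `aemeasurable_sum_tailFn_crowdedActivity`). -/

/-- The scalar FRACTION functional `y ↦ 𝟙{V < y}` (so `(N+1)⁻¹ Σ_i fracFn V (F_i)` is the fraction of spheres whose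
functional exceeds `V`). -/
def fracFn (V y : ℝ) : ℝ := Set.indicator {y : ℝ | V < y} (fun _ => (1 : ℝ)) y

/-- **CROWDED ACTIVITY — UNIFORM INTEGRABILITY** (stub 6a; OPEN, a-priori-estimate kind; PURE UI shape since
cycle 3 — its former a.e.-measurability conjunct is landed for all data, p110232
`CollisionActivityTailsCrowdedActivityMeasurable.aemeasurable_sum_tailFn_crowdedActivity`, and is discharged inside
`crowdedCollisionTails_of`). In the crux's frame:
`∀ t < T ∀ ε ∃ M ∃ τ₀ ∀ τ ≥ τ₀ ∃ N₀ ∀ N ≥ N₀ ∀ s ≤ t`, `E_{λ₀}[(N+1)⁻¹ Σ_i 𝟙{M < Fcr_i} Fcr_i] ≤ ε`. The `∃ τ₀`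
AFTER `M` is essential (Disproof §7b: uniformly over all windows the statement is false by mass escape as
`τ → 0`). Any `N`-uniform bound on a moment of order `> 1` of `Fcr_i` under the true law would give it; none is
known (even the mean of the activity has no `N`-uniform a-priori bound on `𝕋³`); with `CrowdedFractionLLN` it is
EQUIVALENT to the crux-shaped `CrowdedCollisionTails` (Negative/ShapeSeparation p106653). -/
def CrowdedActivityUI : Prop :=
  ∀ (a₀ θ₀ : T3 → ℝ) (u₀ : T3 → V3), Continuous a₀ → Continuous θ₀ → Continuous u₀ →
    (∀ x, 0 < a₀ x) → (∀ x, 0 < θ₀ x) → ∃ σ₀ : ℝ, 0 < σ₀ ∧ ∀ σ : ℝ, 0 < σ → σ < σ₀ →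
    ∀ (T : ℝ) (ρ θ : ℝ → T3 → ℝ) (u : ℝ → T3 → V3), IsHardSphereEulerSolution σ T ρ u θ →
    ∀ Φ : (N : ℕ) → Flow σ N,
    TendstoHydroFieldsAt (fun N => localGibbsLaw σ a₀ u₀ θ₀ N (Φ N)) Φ ρ u θ 0 →
    ∀ t ∈ Set.Ico 0 T, ∀ ε : ℝ, 0 < ε → ∃ M : ℝ,
    ∃ τ₀ : ℝ, 0 < τ₀ ∧ ∀ τ : ℝ, τ₀ ≤ τ → ∃ N₀ : ℕ, ∀ N : ℕ, N₀ ≤ N → ∀ s ∈ Set.Icc 0 t,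
      ∫⁻ z, ENNReal.ofReal (((N : ℝ) + 1)⁻¹ * ∑ i : Fin (N + 1), tailFn M (crowdedActivity (Φ N) τ s i z))
        ∂(localGibbsLaw σ a₀ u₀ θ₀ N (Φ N)) ≤ ENNReal.ofReal ε

/-- **CROWDED ACTIVITY — FRACTION LLN** (stub 6b; OPEN, the dynamical residual). In the crux's frame and quantifier
shape: the expected FRACTION of spheres whose crowded collisional activity exceeds a fixed level `V ≥ V₀` vanishes
as `τ → ∞` after `N → ∞`, uniformly in `s ≤ t < T` — a law of large numbers in probability, in the window length,
for the crowded activity seen by a uniformly chosen tagged sphere under the TRUE pre-shock law (no long-lived caging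
/ co-moving condensation of a positive FRACTION of spheres). -/
def CrowdedFractionLLN : Prop :=
  ∀ (a₀ θ₀ : T3 → ℝ) (u₀ : T3 → V3), Continuous a₀ → Continuous θ₀ → Continuous u₀ →
    (∀ x, 0 < a₀ x) → (∀ x, 0 < θ₀ x) → ∃ σ₀ : ℝ, 0 < σ₀ ∧ ∀ σ : ℝ, 0 < σ → σ < σ₀ →
    ∀ (T : ℝ) (ρ θ : ℝ → T3 → ℝ) (u : ℝ → T3 → V3), IsHardSphereEulerSolution σ T ρ u θ →
    ∀ Φ : (N : ℕ) → Flow σ N,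
    TendstoHydroFieldsAt (fun N => localGibbsLaw σ a₀ u₀ θ₀ N (Φ N)) Φ ρ u θ 0 →
    ∀ t ∈ Set.Ico 0 T, ∃ V₀ : ℝ, 0 < V₀ ∧ ∀ V : ℝ, V₀ ≤ V → ∀ δ : ℝ, 0 < δ →
    ∃ τ₀ : ℝ, 0 < τ₀ ∧ ∀ τ : ℝ, τ₀ ≤ τ → ∃ N₀ : ℕ, ∀ N : ℕ, N₀ ≤ N → ∀ s ∈ Set.Icc 0 t,
      ∫⁻ z, ENNReal.ofReal (((N : ℝ) + 1)⁻¹ * ∑ i : Fin (N + 1), fracFn V (crowdedActivity (Φ N) τ s i z))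
        ∂(localGibbsLaw σ a₀ u₀ θ₀ N (Φ N)) ≤ ENNReal.ofReal δ

/-! ### §1c Split of stub 5 (cycle 2 reshape, stub worker): `L¹` tail = QUADRATIC-VELOCITY UI × FRACTION LLN

By hard-core packing (≤ 125 centres within `2ε`) the `M'`-tail of `F²_i` is dominated PATHWISE by the window average
of the FAST kinetic energy `Σ_k |v_k|² 𝟙{M < |v_k|}` (`M' = 1000 M²`), whose expectation along the true flow is
controlled by the EXISTING open support item `KineticEnergyTails` (stmt-AtomisticToContinuum-13087, route
JParityClosure: uniform integrability of the kinetic energy before the shock, UI shape `∀ ε ∃ M`); the level-`V` part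
is `M'` times the FRACTION of spheres with `F²_i > V`, an in-probability LLN in the crux's shape
(`NearFieldFractionLLN`). Reduction `KineticEnergyTails → NearFieldFractionLLN → NearFieldKineticTails`: stub 5d,
kernel-checked by the stub worker (work/stubs/stub_nearFieldKineticTails.lean, to land as
`Theorems/OneFlightGossipEngineCollisionActivityTailsNearFieldKineticTails.lean`). -/

/-- **NEAR-FIELD FRACTION LLN** (stub 5b; OPEN, the dynamical residual) — the minimal missing dynamical fact behind
stub 5. In the crux's frame and quantifier shape: the expected fraction of spheres whose window-averaged near-field
relative kinetic energy `F²_i` exceeds `V ≥ V₀` vanishes as `τ → ∞` after `N → ∞`, uniformly in `s ≤ t < T`, under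
the TRUE law `λ₀ ∘ Φ`: a law of large numbers in probability, in the window length, for the co-moving `2ε`-ball
kinetic occupation of a uniformly chosen tagged sphere. -/
def NearFieldFractionLLN : Prop :=
  ∀ (a₀ θ₀ : T3 → ℝ) (u₀ : T3 → V3), Continuous a₀ → Continuous θ₀ → Continuous u₀ →
    (∀ x, 0 < a₀ x) → (∀ x, 0 < θ₀ x) → ∃ σ₀ : ℝ, 0 < σ₀ ∧ ∀ σ : ℝ, 0 < σ → σ < σ₀ →
    ∀ (T : ℝ) (ρ θ : ℝ → T3 → ℝ) (u : ℝ → T3 → V3), IsHardSphereEulerSolution σ T ρ u θ →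
    ∀ Φ : (N : ℕ) → Flow σ N,
    TendstoHydroFieldsAt (fun N => localGibbsLaw σ a₀ u₀ θ₀ N (Φ N)) Φ ρ u θ 0 →
    ∀ t ∈ Set.Ico 0 T, ∃ V₀ : ℝ, 0 < V₀ ∧ ∀ V : ℝ, V₀ ≤ V → ∀ δ : ℝ, 0 < δ →
    ∃ τ₀ : ℝ, 0 < τ₀ ∧ ∀ τ : ℝ, τ₀ ≤ τ → ∃ N₀ : ℕ, ∀ N : ℕ, N₀ ≤ N → ∀ s ∈ Set.Icc 0 t,
      ∫⁻ z, ENNReal.ofReal (((N : ℝ) + 1)⁻¹ * ∑ i : Fin (N + 1), fracFn V (nearFieldKinetic (Φ N) τ s i z))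
        ∂(localGibbsLaw σ a₀ u₀ θ₀ N (Φ N)) ≤ ENNReal.ofReal δ

/-- The quadratic velocity tail `v ↦ |v|² 𝟙{M < |v|}` (the integrand of `KineticEnergyTails`). -/
def kinTail (M : ℝ) (v : V3) : ℝ := Set.indicator {v : V3 | M < ‖v‖} (fun v => ‖v‖ ^ 2) v

/-- The FAST near-field relative kinetic energy at `i`: `Σ_{j ≠ i, dist ≤ r} 𝟙{L < |v_j − v_i|²} |v_j − v_i|²`. -/
def relKineticFast {N : ℕ} (z : Cfg N) (i : Fin (N + 1)) (r L : ℝ) : ℝ :=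
  ∑ j : Fin (N + 1), if j ≠ i ∧ tdist (z j).1 (z i).1 ≤ r then tailFn L (‖(z j).2 - (z i).2‖ ^ 2) else 0

/-- The empirical quadratic velocity tail `(N+1)⁻¹ Σ_i |v_i|² 𝟙{M < |v_i|}` of a configuration. -/
def kinTailAvg {N : ℕ} (M : ℝ) (y : Cfg N) : ℝ := ((N : ℝ) + 1)⁻¹ * ∑ i, kinTail M (y i).2

/-- **NEAR-FIELD STATICS** (stub 5e; PROVED by the stub worker, lands as its own helper file): hard-core packing at
radius `2ε` (≤ 125 centres) gives, in the hard-sphere domain, the truncation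
`Σ_{near}|v_j − v_i|² ≤ 125·4M² + (fast part at level 4M²)_i` and the double-counting bound
`Σ_i (fast part)_i ≤ 1000 Σ_i |v_i|² 𝟙{M < |v_i|}` (a fast relative velocity needs a fast partner). -/
def NearFieldStatics : Prop :=
  ∀ (N : ℕ) (ε : ℝ), 0 < ε → ∀ y : Cfg N, y ∈ hardSphereDomain (Torus.geometry (Fin 3)) (N + 1) ε →
    ∀ M : ℝ,
      (∀ i : Fin (N + 1), relKineticNear y i (2 * ε) ≤ 125 * (4 * M ^ 2) + relKineticFast y i (2 * ε) (4 * M ^ 2)) ∧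
      ∑ i : Fin (N + 1), relKineticFast y i (2 * ε) (4 * M ^ 2) ≤ 1000 * ∑ i : Fin (N + 1), kinTail M (y i).2

/-- **NEAR-FIELD PATHWISE BOUND** (stub 5f; PROVED by the stub worker, lands as its own helper file): on the good
set, for `σ, τ > 0`, every cut-off `M` and level `V`,
`(N+1)⁻¹ Σ_i 𝟙{V < F²_i} F²_i ≤ 2000 · w⁻¹ ∫_s^{s+w} (N+1)⁻¹ Σ_i |v_i(t)|² 𝟙{M < |v_i(t)|} dt
  + 1000 M² · (N+1)⁻¹ Σ_i 𝟙{V < F²_i}`. -/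
def NearFieldPathwise : Prop :=
  ∀ (σ : ℝ), 0 < σ → ∀ (N : ℕ) (Φ : Flow σ N) (τ : ℝ), 0 < τ → ∀ (s : ℝ), ∀ z ∈ Φ.good, ∀ M V : ℝ,
    ((N : ℝ) + 1)⁻¹ * ∑ i : Fin (N + 1), tailFn V (nearFieldKinetic Φ τ s i z) ≤
      2000 * ((window τ N)⁻¹ * ∫ t in s..(s + window τ N), kinTailAvg M (Φ.flow t z)) +
        1000 * M ^ 2 * (((N : ℝ) + 1)⁻¹ * ∑ i : Fin (N + 1), fracFn V (nearFieldKinetic Φ τ s i z))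

/-! ## §2 Tool lemmas (scalar tail functional, measurability, `lintegral` bookkeeping) -/

/-- On the tail `V < y` the functional is the identity. -/
theorem tailFn_of_lt {V y : ℝ} (h : V < y) : tailFn V y = y :=
  Set.indicator_of_mem (show y ∈ {y : ℝ | V < y} from h) _

/-- Off the tail (`y ≤ V`) the functional vanishes. -/
theorem tailFn_of_le {V y : ℝ} (h : y ≤ V) : tailFn V y = 0 :=
  Set.indicator_of_notMem (show y ∉ {y : ℝ | V < y} from fun h' => (not_lt.2 h) h') _

/-- The tail functional is nonnegative on nonnegative arguments. -/
theorem tailFn_nonneg {V y : ℝ} (hy : 0 ≤ y) : 0 ≤ tailFn V y :=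
  Set.indicator_apply_nonneg fun _ => hy

/-- **Pointwise Chebyshev.** Above a positive level `V`, `𝟙{V < y} y ≤ y² / V`. -/
theorem tailFn_le_sq_div {V : ℝ} (hV : 0 < V) (y : ℝ) : tailFn V y ≤ y ^ 2 / V := by
  by_cases h : V < y
  · rw [tailFn_of_lt h, le_div_iff₀ hV, sq]
    exact mul_le_mul_of_nonneg_left h.le (hV.trans h).le
  · rw [tailFn_of_le (not_lt.1 h)]
    positivity

/-- `tailFn V` is measurable. -/
theorem measurable_tailFn (V : ℝ) : Measurable (tailFn V) :=
  measurable_id.indicator (measurableSet_lt measurable_const measurable_id)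

/-- On the tail the fraction functional is `1`. -/
theorem fracFn_of_lt {V y : ℝ} (h : V < y) : fracFn V y = 1 :=
  Set.indicator_of_mem (show y ∈ {y : ℝ | V < y} from h) _

/-- Off the tail the fraction functional is `0`. -/
theorem fracFn_of_le {V y : ℝ} (h : y ≤ V) : fracFn V y = 0 :=
  Set.indicator_of_notMem (show y ∉ {y : ℝ | V < y} from fun h' => (not_lt.2 h) h') _

/-- The fraction functional is nonnegative. -/
theorem fracFn_nonneg (V y : ℝ) : 0 ≤ fracFn V y :=
  Set.indicator_apply_nonneg fun _ => zero_le_one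

/-- **Truncation.** `𝟙{V < y} y ≤ 𝟙{M < y} y + M⁺ 𝟙{V < y}` for `y ≥ 0` (on `{V < y}`: either `M < y` and the first
term is `y`, or `y ≤ M ≤ M⁺` and the second term is `M⁺`). -/
theorem tailFn_le_tailFn_add_mul_fracFn (V M : ℝ) {y : ℝ} (hy : 0 ≤ y) :
    tailFn V y ≤ tailFn M y + max M 0 * fracFn V y := by
  by_cases hV : V < y
  · rw [tailFn_of_lt hV, fracFn_of_lt hV, mul_one]
    by_cases hMy : M < y
    · rw [tailFn_of_lt hMy]
      linarith [le_max_right M 0]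
    · rw [tailFn_of_le (not_lt.1 hMy)]
      linarith [not_lt.1 hMy, le_max_left M 0]
  · rw [tailFn_of_le (not_lt.1 hV), fracFn_of_le (not_lt.1 hV), mul_zero, add_zero]
    exact tailFn_nonneg hy

/-- The minimal-image distance of two centres is a measurable function of the configuration. -/
theorem measurable_tdist {N : ℕ} (j i : Fin (N + 1)) :
    Measurable fun z : Cfg N => tdist (z j).1 (z i).1 :=
  (Torus.measurable_geometry_sepVec.comp
    ((measurable_pi_apply j).fst.prodMk (measurable_pi_apply i).fst)).norm

/-- The near-field relative momentum at `i` is a measurable function of the configuration. -/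
theorem measurable_relMomentumNear {N : ℕ} (i : Fin (N + 1)) (r : ℝ) :
    Measurable fun z : Cfg N => relMomentumNear z i r := by
  unfold relMomentumNear
  refine Finset.measurable_sum _ fun j _ => Measurable.ite ?_ ?_ measurable_const
  · exact (MeasurableSet.const (j ≠ i)).inter
      (measurableSet_le (measurable_tdist j i) measurable_const)
  · exact ((measurable_pi_apply j).snd.sub (measurable_pi_apply i).snd).norm

/-- The endpoint term `F¹_i` is a measurable function of the initial datum. -/
theorem measurable_endpointTerm {σ : ℝ} {N : ℕ} (Φ : Flow σ N) (τ s : ℝ) (i : Fin (N + 1)) :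
    Measurable fun z : Cfg N => endpointTerm Φ τ s i z := by
  unfold endpointTerm
  exact (((measurable_relMomentumNear i _).comp (Φ.measurable_flow s)).add
    ((measurable_relMomentumNear i _).comp (Φ.measurable_flow _))).const_mul _

/-- The tail sum of the endpoint terms is a measurable function of the initial datum. -/
theorem measurable_sum_tailFn_endpointTerm {σ : ℝ} {N : ℕ} (Φ : Flow σ N) (τ s V : ℝ) :
    Measurable fun z : Cfg N => ∑ i : Fin (N + 1), tailFn V (endpointTerm Φ τ s i z) :=
  Finset.measurable_sum _ fun i _ => (measurable_tailFn V).comp (measurable_endpointTerm Φ τ s i)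

/-- Under the local Gibbs law almost every datum is good (the law is absolutely continuous with respect to the
Liouville measure, whose complement of the good set is null). -/
theorem ae_mem_good_localGibbsLaw (σ : ℝ) (a₀ θ₀ : T3 → ℝ) (u₀ : T3 → V3) (N : ℕ) (Φ : Flow σ N) :
    ∀ᵐ z ∂(localGibbsLaw σ a₀ u₀ θ₀ N Φ), z ∈ Φ.good := by
  have hac : localGibbsLaw σ a₀ u₀ θ₀ N Φ ≪ liouville (Torus.geometry (Fin 3)) (N + 1) (hsDiameter σ N) := by
    rw [localGibbsLaw_eq]
    exact localGibbsMeasure_absolutelyContinuous σ a₀ u₀ θ₀ N Φ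
  exact hac.ae_le Φ.ae_mem_good

/-- The `lintegral` Chebyshev step: if `h ≤ c g` almost everywhere with `c ≥ 0` and `∫⁻ ofReal g ≤ ofReal B`, then
`∫⁻ ofReal h ≤ ofReal (c B)`. -/
theorem lintegral_ofReal_le_of_le_mul {α : Type*} [MeasurableSpace α] {μ : Measure α}
    {h g : α → ℝ} {c B : ℝ} (hc : 0 ≤ c) (hle : ∀ᵐ x ∂μ, h x ≤ c * g x)
    (hb : ∫⁻ x, ENNReal.ofReal (g x) ∂μ ≤ ENNReal.ofReal B) :
    ∫⁻ x, ENNReal.ofReal (h x) ∂μ ≤ ENNReal.ofReal (c * B) := by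
  calc ∫⁻ x, ENNReal.ofReal (h x) ∂μ
      ≤ ∫⁻ x, ENNReal.ofReal c * ENNReal.ofReal (g x) ∂μ := by
        refine lintegral_mono_ae (hle.mono fun x hx => ?_)
        rw [← ENNReal.ofReal_mul hc]
        exact ENNReal.ofReal_le_ofReal hx
    _ = ENNReal.ofReal c * ∫⁻ x, ENNReal.ofReal (g x) ∂μ :=
        lintegral_const_mul' _ _ ENNReal.ofReal_ne_top
    _ ≤ ENNReal.ofReal c * ENNReal.ofReal B := mul_le_mul_right hb _
    _ = ENNReal.ofReal (c * B) := (ENNReal.ofReal_mul hc).symm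

/-- Splitting the `lintegral` of `ofReal (c (A₁ + A₂ + A₃))` when `A₁, A₂` are a.e.-measurable and `c ≥ 0`. -/
theorem lintegral_ofReal_mul_add_three_le {α : Type*} [MeasurableSpace α] {μ : Measure α}
    {A₁ A₂ A₃ : α → ℝ} {c : ℝ} (hc : 0 ≤ c) (h₁ : AEMeasurable A₁ μ) (h₂ : AEMeasurable A₂ μ) :
    ∫⁻ x, ENNReal.ofReal (c * (A₁ x + A₂ x + A₃ x)) ∂μ ≤
      ENNReal.ofReal c * (∫⁻ x, ENNReal.ofReal (A₁ x) ∂μ + ∫⁻ x, ENNReal.ofReal (A₂ x) ∂μ +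
        ∫⁻ x, ENNReal.ofReal (A₃ x) ∂μ) := by
  have hm₁ : AEMeasurable (fun x => ENNReal.ofReal (A₁ x)) μ := h₁.ennreal_ofReal
  have hm₂ : AEMeasurable (fun x => ENNReal.ofReal (A₂ x)) μ := h₂.ennreal_ofReal
  calc ∫⁻ x, ENNReal.ofReal (c * (A₁ x + A₂ x + A₃ x)) ∂μ
      ≤ ∫⁻ x, ENNReal.ofReal c * (ENNReal.ofReal (A₁ x) + ENNReal.ofReal (A₂ x) + ENNReal.ofReal (A₃ x)) ∂μ := by
        refine lintegral_mono fun x => ?_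
        rw [ENNReal.ofReal_mul hc]
        refine mul_le_mul_right ?_ _
        exact ENNReal.ofReal_add_le.trans (add_le_add ENNReal.ofReal_add_le le_rfl)
    _ = ENNReal.ofReal c * ∫⁻ x, (ENNReal.ofReal (A₁ x) + ENNReal.ofReal (A₂ x) + ENNReal.ofReal (A₃ x)) ∂μ :=
        lintegral_const_mul' _ _ ENNReal.ofReal_ne_top
    _ = ENNReal.ofReal c * (∫⁻ x, ENNReal.ofReal (A₁ x) ∂μ + ∫⁻ x, ENNReal.ofReal (A₂ x) ∂μ +
        ∫⁻ x, ENNReal.ofReal (A₃ x) ∂μ) := by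
        rw [lintegral_add_left' (hm₁.fun_add hm₂), lintegral_add_left' hm₁]

/-! ## §3 The stubs -/

/-- STUB 1 (landed, `…ActivityDomination.stub_activityDomination`, p94309): the co-moving pair-virial lever. -/
theorem stub_activityDomination : ActivityDomination :=
  CollisionActivityTailsActivityDomination.stub_activityDomination

/-- STUB 2 (landed, `…EndpointKinematics.stub_endpointKinematics`, p86808; same statement over a verbatim copy of
the vocabulary, definitionally equal). -/
theorem stub_endpointKinematics : EndpointKinematics :=
  CollisionActivityTailsEndpointKinematics.stub_endpointKinematics

/-- The kinetic energy as a multiple of the mean one-body observable `|v|²`: `E(z) = ((N+1)/2) · (N+1)⁻¹ Σᵢ |vᵢ|²`,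
in `ℝ≥0∞`. -/
theorem ofReal_configEnergy_eq (N : ℕ) (z : Config (N + 1) (Fin 3) T3) :
    ENNReal.ofReal (configEnergy z) =
      ENNReal.ofReal (((N : ℝ) + 1) / 2) *
        ENNReal.ofReal (((N : ℝ) + 1)⁻¹ * ∑ i, ‖(z i).2‖ ^ 2) := by
  rw [← ENNReal.ofReal_mul (by positivity), configEnergy]
  congr 1
  have hN : (N : ℝ) + 1 ≠ 0 := by positivity
  field_simp

/-- STUB 3 (landed as `…MeanEnergyBound.stub_meanEnergyBound`, p88348; proof repeated verbatim because that
module's farm build is stale): `∫ E dλ_N ≤ (sup |u₀|²/2 + 3 sup θ₀/2 + 1)(N + 1)` by disintegration into positions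
and independent Gaussian velocities. -/
theorem stub_meanEnergyBound : MeanEnergyBound := by
  intro a₀ θ₀ u₀ ha hθ hu ha0 hθ0
  obtain ⟨Θ, hΘ0, hΘ⟩ := exists_forall_abs_le_of_continuous hθ
  obtain ⟨U, hU0, hU⟩ := exists_forall_abs_le_of_continuous hu.norm
  have hΘ' : ∀ y, θ₀ y ≤ Θ := fun y => (le_abs_self _).trans (hΘ y)
  have hU' : ∀ y, ‖u₀ y‖ ≤ U := fun y => (le_abs_self _).trans (hU y)
  refine ⟨U ^ 2 / 2 + 3 * Θ / 2 + 1, by positivity, ?_⟩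
  intro σ _hσ _hσ2 N Φ
  have ha0' : ∀ x, 0 ≤ a₀ x := fun x => (ha0 x).le
  have hB : ∀ y : T3, ∫⁻ w, ENNReal.ofReal (‖w‖ ^ 2) ∂gaussMeasure (u₀ y) (θ₀ y) ≤
      ENNReal.ofReal (U ^ 2 + 3 * Θ) := by
    intro y
    rw [lintegral_norm_sq_gaussMeasure (u₀ y) (hθ0 y)]
    refine ENNReal.ofReal_le_ofReal ?_
    have hUy : ‖u₀ y‖ ^ 2 ≤ U ^ 2 := pow_le_pow_left₀ (norm_nonneg _) (hU' y) 2
    linarith [hΘ' y]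
  have hmean : ∫⁻ z, ENNReal.ofReal (((N : ℝ) + 1)⁻¹ * ∑ i, ‖(z i).2‖ ^ 2)
      ∂localGibbsMeasure σ a₀ u₀ θ₀ N ≤ ENNReal.ofReal (U ^ 2 + 3 * Θ) :=
    lintegral_meanVelObs_localGibbsMeasure_le ha hθ hu ha0' hθ0 (f := fun v : V3 => ‖v‖ ^ 2)
      (by fun_prop) (fun v => sq_nonneg _) hB σ N
  rw [localGibbsLaw_eq]
  simp_rw [ofReal_configEnergy_eq N]
  rw [lintegral_const_mul' _ _ ENNReal.ofReal_ne_top]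
  calc ENNReal.ofReal (((N : ℝ) + 1) / 2) *
        ∫⁻ z, ENNReal.ofReal (((N : ℝ) + 1)⁻¹ * ∑ i, ‖(z i).2‖ ^ 2) ∂localGibbsMeasure σ a₀ u₀ θ₀ N
      ≤ ENNReal.ofReal (((N : ℝ) + 1) / 2) * ENNReal.ofReal (U ^ 2 + 3 * Θ) :=
        mul_le_mul_right hmean _
    _ = ENNReal.ofReal ((U ^ 2 / 2 + 3 * Θ / 2) * ((N : ℝ) + 1)) := by
        rw [← ENNReal.ofReal_mul (by positivity)]
        congr 1
        ring
    _ ≤ ENNReal.ofReal ((U ^ 2 / 2 + 3 * Θ / 2 + 1) * ((N : ℝ) + 1)) :=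
        ENNReal.ofReal_le_ofReal (mul_le_mul_of_nonneg_right (by linarith) (by positivity))

/-- Pointwise step on a good datum: `(N+1)⁻¹ Σ_i 𝟙{V < F¹_i} F¹_i ≤ (N+1)⁻¹ (K (σ/τ)² / V) · E(z)`. -/
theorem avgTail_endpointTerm_le {σ : ℝ} {N : ℕ} (Φ : Flow σ N) {τ s V K : ℝ} (hV : 0 < V)
    {z : Cfg N}
    (hz : ∑ i : Fin (N + 1), (endpointTerm Φ τ s i z) ^ 2 ≤ K * (σ / τ) ^ 2 * configEnergy z) :
    ((N : ℝ) + 1)⁻¹ * ∑ i, tailFn V (endpointTerm Φ τ s i z) ≤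
      ((N : ℝ) + 1)⁻¹ * (K * (σ / τ) ^ 2 / V) * configEnergy z := by
  have hN : (0 : ℝ) ≤ ((N : ℝ) + 1)⁻¹ := by positivity
  calc ((N : ℝ) + 1)⁻¹ * ∑ i, tailFn V (endpointTerm Φ τ s i z)
      ≤ ((N : ℝ) + 1)⁻¹ * ∑ i, (endpointTerm Φ τ s i z) ^ 2 / V :=
        mul_le_mul_of_nonneg_left (Finset.sum_le_sum fun i _ => tailFn_le_sq_div hV _) hN
    _ = ((N : ℝ) + 1)⁻¹ * ((∑ i, (endpointTerm Φ τ s i z) ^ 2) / V) := by rw [Finset.sum_div]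
    _ ≤ ((N : ℝ) + 1)⁻¹ * (K * (σ / τ) ^ 2 * configEnergy z / V) :=
        mul_le_mul_of_nonneg_left (div_le_div_of_nonneg_right hz hV.le) hN
    _ = ((N : ℝ) + 1)⁻¹ * (K * (σ / τ) ^ 2 / V) * configEnergy z := by ring

/-- STUB 4 (landed as `…EndpointTails.stub_endpointTails`, p89060; proof repeated verbatim because that module's
farm build is stale): Chebyshev with `τ₀ = √(K σ² e₀ / (V ε)) + 1`, `σ₀ = 1/8`. -/
theorem stub_endpointTails : EndpointKinematics → MeanEnergyBound → EndpointTails := by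
  rintro ⟨K, hK0, hK⟩ hE a₀ θ₀ u₀ ha hθ hu ha0 hθ0
  obtain ⟨e₀, he₀, hE⟩ := hE a₀ θ₀ u₀ ha hθ hu ha0 hθ0
  refine ⟨1 / 8, by norm_num, ?_⟩
  intro σ hσ hσ8 V hV ε hε
  have hσ8' : σ ≤ 1 / 8 := hσ8.le
  have hσ2 : σ ≤ 1 / 2 := by linarith
  set A : ℝ := K * σ ^ 2 * e₀ / (V * ε) with hA
  have hA0 : 0 ≤ A := by positivity
  refine ⟨Real.sqrt A + 1, by positivity, ?_⟩
  intro τ hτ N Φ s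
  have hτpos : 0 < τ := by linarith [Real.sqrt_nonneg A]
  have hτA : A ≤ τ ^ 2 := by
    have h1 : Real.sqrt A ≤ τ := by linarith
    calc A = Real.sqrt A ^ 2 := (Real.sq_sqrt hA0).symm
      _ ≤ τ ^ 2 := pow_le_pow_left₀ (Real.sqrt_nonneg A) h1 2
  refine ⟨(measurable_sum_tailFn_endpointTerm Φ τ s V).aemeasurable, ?_⟩
  set c : ℝ := ((N : ℝ) + 1)⁻¹ * (K * (σ / τ) ^ 2 / V) with hc
  have hc0 : 0 ≤ c := by positivity
  have hcε : c * (e₀ * ((N : ℝ) + 1)) ≤ ε := by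
    have hN : (N : ℝ) + 1 ≠ 0 := by positivity
    have hτ0 : τ ≠ 0 := hτpos.ne'
    have hV0 : V ≠ 0 := hV.ne'
    have hε0 : ε ≠ 0 := hε.ne'
    have hmain : K * σ ^ 2 * e₀ ≤ τ ^ 2 * (V * ε) := (div_le_iff₀ (by positivity)).1 hτA
    have h1 : c * (e₀ * ((N : ℝ) + 1)) = K * σ ^ 2 * e₀ / (τ ^ 2 * V) := by
      rw [hc]
      field_simp
    rw [h1, div_le_iff₀ (by positivity)]
    calc K * σ ^ 2 * e₀ ≤ τ ^ 2 * (V * ε) := hmain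
      _ = ε * (τ ^ 2 * V) := by ring
  have hle : ∀ᵐ z ∂(localGibbsLaw σ a₀ u₀ θ₀ N Φ),
      ((N : ℝ) + 1)⁻¹ * ∑ i, tailFn V (endpointTerm Φ τ s i z) ≤ c * configEnergy z := by
    filter_upwards [ae_mem_good_localGibbsLaw σ a₀ θ₀ u₀ N Φ] with z hz
    exact avgTail_endpointTerm_le Φ hV (hK σ hσ hσ8' N Φ τ hτpos s z hz)
  exact (lintegral_ofReal_le_of_le_mul hc0 hle (hE σ hσ hσ2 N Φ)).trans
    (ENNReal.ofReal_le_ofReal hcε)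

/-- OPTIONAL SPLIT of stub 5 (LANDED p106773, `…NearFieldKineticTails.stub_nearFieldReduction`, axioms {propext,
Classical.choice, Quot.sound}; discharged by import — the landed statement is over byte-identical copies of this file's
`NearFieldKineticTails` / `NearFieldFractionLLN`, definitionally equal): the EXISTING item stmt-13087
`JParityClosure.KineticEnergyTails` (quadratic-velocity UI along the true flow; inside both routes supplied by their binder
`EnergyCurrentTails` stmt-9235) and the in-probability window LLN `NearFieldFractionLLN` (§1c) imply stub 5 — packing + Tonelli.
Conversely stub 5 implies `NearFieldFractionLLN` (p106773 `nearFieldFractionLLN_of_nearFieldKineticTails`), so in-route stub 5 is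
EQUIVALENT to the fraction LLN; standalone it is the canonical TAIL-shaped statement B′ of PROMOTE.md v3. -/
theorem stub_nearFieldReduction : KineticEnergyTails → NearFieldFractionLLN → NearFieldKineticTails :=
  fun hK hF => CollisionActivityTailsNearFieldKineticTails.stub_nearFieldReduction hK hF

/-- STUB 5e (LANDED p102147, `…NearFieldKineticTailsStatics.stub_nearFieldStatics`, discharged by import; the two
statements are definitionally equal copies of the same vocabulary): near-field statics. -/
theorem stub_nearFieldStatics : NearFieldStatics :=
  CollisionActivityTailsNearFieldKineticTails.stub_nearFieldStatics

/-- STUB 5f (LANDED p105299, `…NearFieldKineticTailsPathwise.stub_nearFieldPathwise`, discharged by import): the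
pathwise bound. -/
theorem stub_nearFieldPathwise : NearFieldPathwise :=
  CollisionActivityTailsNearFieldKineticTails.stub_nearFieldPathwise

/-- **STUB 5 — OPEN (B′ of PROMOTE.md v3): NEAR-FIELD KINETIC TAILS**, the crux-shaped tail statement for `F²` (§1;
`TailStatement nearFieldKinetic` with its all-data measurability conjunct). Registered open residual of the line since cycle 4's
re-merge (cycles 2–3 carried it split as 13087 + `NearFieldFractionLLN` via `stub_nearFieldReduction`, which stays available
above); one good window scale per level and accuracy suffices (`…OneWindowTails.nearFieldKineticTails_iff_oneWindow`). -/
theorem stub_nearFieldKineticTails : NearFieldKineticTails := by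
  sorry

/-- **OPTIONAL SPLIT of stub 6** (proved): uniform integrability (pure UI shape, §1b `CrowdedActivityUI`) + fraction LLN
(§1b `CrowdedFractionLLN`) ⟹ the crux-shaped `L¹` tail statement `CrowdedCollisionTails` (and conversely stub 6 implies both:
Negative/ShapeSeparation p106653, Disproof §7g — so A′ := stub 6 ⟺ A ∧ C of PROMOTE.md v2). Given `V ≥ V₀` and `ε`: take `M` from UI at accuracy `ε/2`, then
`δ = ε / (2 (M⁺ + 1))` in the fraction LLN; pointwise `𝟙{V<Fcr}Fcr ≤ 𝟙{M<Fcr}Fcr + M⁺𝟙{V<Fcr}`, and the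
`lintegral` splits because the first summand is a.e.-measurable for ALL data (landed p110232,
`aemeasurable_sum_tailFn_crowdedActivity`). -/
theorem crowdedCollisionTails_of (hU : CrowdedActivityUI) (hL : CrowdedFractionLLN) : CrowdedCollisionTails := by
  intro a₀ θ₀ u₀ ha hθ hu ha0 hθ0
  obtain ⟨σ₁, hσ₁, hU⟩ := hU a₀ θ₀ u₀ ha hθ hu ha0 hθ0
  obtain ⟨σ₂, hσ₂, hL⟩ := hL a₀ θ₀ u₀ ha hθ hu ha0 hθ0
  refine ⟨min (min σ₁ σ₂) (1 / 2), lt_min (lt_min hσ₁ hσ₂) (by norm_num), ?_⟩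
  intro σ hσ hσlt T ρ θ u hsol Φ hLLN t ht
  have hσ₁' : σ < σ₁ := hσlt.trans_le ((min_le_left _ _).trans (min_le_left _ _))
  have hσ₂' : σ < σ₂ := hσlt.trans_le ((min_le_left _ _).trans (min_le_right _ _))
  have hU := hU σ hσ hσ₁' T ρ θ u hsol Φ hLLN t ht
  obtain ⟨V₀, hV₀, hL⟩ := hL σ hσ hσ₂' T ρ θ u hsol Φ hLLN t ht
  refine ⟨V₀, hV₀, ?_⟩
  intro V hV e he
  obtain ⟨M, τ₁, hτ₁, hU⟩ := hU (e / 2) (half_pos he)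
  set M' : ℝ := max M 0 with hM'
  have hM'0 : 0 ≤ M' := le_max_right _ _
  set δ : ℝ := e / (2 * (M' + 1)) with hδ
  have hδ0 : 0 < δ := by positivity
  obtain ⟨τ₂, hτ₂, hL⟩ := hL V hV δ hδ0
  refine ⟨max τ₁ τ₂, lt_max_of_lt_left hτ₁, ?_⟩
  intro τ hτ
  have hτ₁' : τ₁ ≤ τ := (le_max_left _ _).trans hτ
  have hτ₂' : τ₂ ≤ τ := (le_max_right _ _).trans hτ
  have hτ0 : 0 < τ := hτ₁.trans_le hτ₁'
  obtain ⟨N₁, hU⟩ := hU τ hτ₁'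
  obtain ⟨N₂, hL⟩ := hL τ hτ₂'
  refine ⟨max N₁ N₂, ?_⟩
  intro N hN s hs
  have hiU := hU N ((le_max_left _ _).trans hN) s hs
  have hmU : AEMeasurable (fun z => ∑ i : Fin (N + 1), tailFn M (crowdedActivity (Φ N) τ s i z))
      (localGibbsLaw σ a₀ u₀ θ₀ N (Φ N)) :=
    CollisionActivityTailsCrowdedActivityMeasurable.aemeasurable_sum_tailFn_crowdedActivity σ a₀ θ₀ u₀ N (Φ N) τ s M
  have hiL := hL N ((le_max_right _ _).trans hN) s hs
  set P := localGibbsLaw σ a₀ u₀ θ₀ N (Φ N) with hP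
  set A : Cfg N → ℝ := fun z =>
    ((N : ℝ) + 1)⁻¹ * ∑ i : Fin (N + 1), tailFn M (crowdedActivity (Φ N) τ s i z) with hA
  set B : Cfg N → ℝ := fun z =>
    ((N : ℝ) + 1)⁻¹ * ∑ i : Fin (N + 1), fracFn V (crowdedActivity (Φ N) τ s i z) with hB
  have hmA : AEMeasurable A P := hmU.const_mul _
  -- pointwise truncation
  have hpt : ∀ z, ((N : ℝ) + 1)⁻¹ * ∑ i : Fin (N + 1), tailFn V (crowdedActivity (Φ N) τ s i z) ≤
      A z + M' * B z := by
    intro z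
    have hN1 : (0 : ℝ) ≤ ((N : ℝ) + 1)⁻¹ := by positivity
    have hsum : ∑ i : Fin (N + 1), tailFn V (crowdedActivity (Φ N) τ s i z) ≤
        ∑ i : Fin (N + 1), (tailFn M (crowdedActivity (Φ N) τ s i z) +
          M' * fracFn V (crowdedActivity (Φ N) τ s i z)) :=
      Finset.sum_le_sum fun i _ =>
        tailFn_le_tailFn_add_mul_fracFn V M (crowdedActivity_nonneg hσ.le (Φ N) hτ0.le s i z)
    calc ((N : ℝ) + 1)⁻¹ * ∑ i : Fin (N + 1), tailFn V (crowdedActivity (Φ N) τ s i z)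
        ≤ ((N : ℝ) + 1)⁻¹ * ∑ i : Fin (N + 1), (tailFn M (crowdedActivity (Φ N) τ s i z) +
          M' * fracFn V (crowdedActivity (Φ N) τ s i z)) := mul_le_mul_of_nonneg_left hsum hN1
      _ = A z + M' * B z := by
          simp only [hA, hB, Finset.sum_add_distrib, ← Finset.mul_sum]
          ring
  have hB0 : ∀ z, 0 ≤ B z := fun z =>
    mul_nonneg (by positivity) (Finset.sum_nonneg fun i _ => fracFn_nonneg _ _)
  -- integrate and split
  have hMδ : M' * δ ≤ e / 2 := by
    rw [hδ]
    rw [mul_div_assoc']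
    rw [div_le_div_iff₀ (by positivity) (by norm_num : (0 : ℝ) < 2)]
    nlinarith [he.le, hM'0]
  calc ∫⁻ z, ENNReal.ofReal (((N : ℝ) + 1)⁻¹ * ∑ i : Fin (N + 1), tailFn V (crowdedActivity (Φ N) τ s i z)) ∂P
      ≤ ∫⁻ z, (ENNReal.ofReal (A z) + ENNReal.ofReal M' * ENNReal.ofReal (B z)) ∂P := by
        refine lintegral_mono fun z => ?_
        rw [← ENNReal.ofReal_mul hM'0]
        exact (ENNReal.ofReal_le_ofReal (hpt z)).trans ENNReal.ofReal_add_le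
    _ = ∫⁻ z, ENNReal.ofReal (A z) ∂P + ENNReal.ofReal M' * ∫⁻ z, ENNReal.ofReal (B z) ∂P := by
        rw [lintegral_add_left' hmA.ennreal_ofReal, lintegral_const_mul' _ _ ENNReal.ofReal_ne_top]
    _ ≤ ENNReal.ofReal (e / 2) + ENNReal.ofReal M' * ENNReal.ofReal δ :=
        add_le_add hiU (mul_le_mul_right hiL _)
    _ ≤ ENNReal.ofReal e := by
        rw [← ENNReal.ofReal_mul hM'0, ← ENNReal.ofReal_add (by positivity) (by positivity)]
        refine ENNReal.ofReal_le_ofReal ?_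
        linarith

/-- **STUB 6 — OPEN (A′ of PROMOTE.md v3): CROWDED COLLISION TAILS**, the crux-shaped tail statement for `Fcr` (§1;
`TailStatement crowdedActivity` definitionally). Registered open residual of the line since cycle 4's re-merge (cycles 2–3
carried it split as `CrowdedActivityUI ∧ CrowdedFractionLLN` via `crowdedCollisionTails_of`, which stays available above); one
good window scale per level and accuracy suffices (`…OneWindowTails.crowdedCollisionTails_iff_oneWindow`). -/
theorem stub_crowdedCollisionTails : CrowdedCollisionTails := by
  sorry

/-! ## §4 Tail algebra -/

/-- Scaling: `𝟙{V < c y} (c y) = c · 𝟙{V/c < y} y` for `c > 0`. -/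
theorem tailFn_mul {V c y : ℝ} (hc : 0 < c) : tailFn V (c * y) = c * tailFn (V / c) y := by
  by_cases h : V / c < y
  · have h' : V < c * y := by rwa [div_lt_iff₀' hc] at h
    rw [tailFn_of_lt h, tailFn_of_lt h']
  · have h' : c * y ≤ V := by
      have := not_lt.1 h
      rwa [← le_div_iff₀' hc]
    rw [tailFn_of_le (not_lt.1 h), tailFn_of_le h', mul_zero]

/-- **Three-term tail algebra.** If `a ≤ x₁ + x₂ + x₃` with `xₘ ≥ 0`, then
`𝟙{V < a} a ≤ 3 (𝟙{V/3 < x₁} x₁ + 𝟙{V/3 < x₂} x₂ + 𝟙{V/3 < x₃} x₃)`: on `{a > V}` the largest `xₘ` exceeds `V/3`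
and `a ≤ 3 max ≤ 3 Σ tails`. -/
theorem tailFn_le_three_sum {V a x₁ x₂ x₃ : ℝ} (h₁ : 0 ≤ x₁) (h₂ : 0 ≤ x₂) (h₃ : 0 ≤ x₃)
    (ha : a ≤ x₁ + x₂ + x₃) :
    tailFn V a ≤ 3 * (tailFn (V / 3) x₁ + tailFn (V / 3) x₂ + tailFn (V / 3) x₃) := by
  have hT₁ := tailFn_nonneg (V := V / 3) h₁
  have hT₂ := tailFn_nonneg (V := V / 3) h₂
  have hT₃ := tailFn_nonneg (V := V / 3) h₃
  by_cases hV : V < a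
  · rw [tailFn_of_lt hV]
    -- the largest of the three exceeds `V / 3` and is its own tail
    have key : ∀ {x y z : ℝ}, 0 ≤ y → 0 ≤ z → y ≤ x → z ≤ x → a ≤ x + y + z →
        a ≤ 3 * (tailFn (V / 3) x + tailFn (V / 3) y + tailFn (V / 3) z) := by
      intro x y z hy hz hyx hzx hsum
      have hx3 : V / 3 < x := by linarith
      rw [tailFn_of_lt hx3]
      linarith [tailFn_nonneg (V := V / 3) hy, tailFn_nonneg (V := V / 3) hz]
    rcases le_total x₂ x₁ with h21 | h12
    · rcases le_total x₃ x₁ with h31 | h13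
      · exact key h₂ h₃ h21 h31 ha
      · have := key h₁ h₂ h13 (h21.trans h13) (by linarith)
        linarith
    · rcases le_total x₃ x₂ with h32 | h23
      · have := key h₁ h₃ h12 h32 (by linarith)
        linarith
      · have := key h₁ h₂ (h12.trans h23) h23 (by linarith)
        linarith
  · rw [tailFn_of_le (not_lt.1 hV)]
    positivity

/-- The domination converted into tails: with `C' = max C 1`,
`𝟙{V < a} a ≤ 3C' (𝟙{V' < F¹} F¹ + 𝟙{V' < F²} F² + 𝟙{V' < Fcr} Fcr)`, `V' = V / (3C')`. -/
theorem tailFn_act_le {V a F₁ F₂ F₃ C : ℝ} (hF₁ : 0 ≤ F₁) (hF₂ : 0 ≤ F₂) (hF₃ : 0 ≤ F₃)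
    (hdom : a ≤ F₁ + C * (F₂ + F₃)) :
    tailFn V a ≤ 3 * max C 1 *
      (tailFn (V / (3 * max C 1)) F₁ + tailFn (V / (3 * max C 1)) F₂ + tailFn (V / (3 * max C 1)) F₃) := by
  set C' := max C 1 with hC'
  have hC'1 : 1 ≤ C' := le_max_right _ _
  have hC'0 : 0 < C' := one_pos.trans_le hC'1
  have hCC' : C ≤ C' := le_max_left _ _
  have hdom' : a ≤ C' * F₁ + C' * F₂ + C' * F₃ := by
    have h1 : F₁ ≤ C' * F₁ := le_mul_of_one_le_left hF₁ hC'1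
    have h2 : C * (F₂ + F₃) ≤ C' * (F₂ + F₃) := mul_le_mul_of_nonneg_right hCC' (add_nonneg hF₂ hF₃)
    linarith
  have h := tailFn_le_three_sum (V := V) (mul_nonneg hC'0.le hF₁) (mul_nonneg hC'0.le hF₂)
    (mul_nonneg hC'0.le hF₃) hdom'
  rw [tailFn_mul hC'0, tailFn_mul hC'0, tailFn_mul hC'0, div_div] at h
  calc tailFn V a ≤ 3 * (C' * tailFn (V / (3 * C')) F₁ + C' * tailFn (V / (3 * C')) F₂ +
        C' * tailFn (V / (3 * C')) F₃) := h
    _ = 3 * C' * (tailFn (V / (3 * C')) F₁ + tailFn (V / (3 * C')) F₂ + tailFn (V / (3 * C')) F₃) := by ring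

/-! ## §5 The composition -/

/-- **COMPOSITION of line `SketchK1`**: the four statements imply the crux (OneFlightGossipEngine decl, by name). -/
theorem collisionActivityTails_of_stubs (hD : ActivityDomination) (hE : EndpointTails)
    (hNF : NearFieldKineticTails) (hCR : CrowdedCollisionTails) :
    Summit.AtomisticToContinuum.HydrodynamicLimit.Theses.OneFlightGossipEngine.CollisionActivityTails := by
  intro a₀ θ₀ u₀ ha hθ hu ha0 hθ0
  obtain ⟨C, hC0, hdom⟩ := hD
  obtain ⟨σ₁, hσ₁, hE⟩ := hE a₀ θ₀ u₀ ha hθ hu ha0 hθ0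
  obtain ⟨σ₂, hσ₂, hNF⟩ := hNF a₀ θ₀ u₀ ha hθ hu ha0 hθ0
  obtain ⟨σ₃, hσ₃, hCR⟩ := hCR a₀ θ₀ u₀ ha hθ hu ha0 hθ0
  refine ⟨min (min σ₁ σ₂) (min σ₃ (1 / 8)), lt_min (lt_min hσ₁ hσ₂) (lt_min hσ₃ (by norm_num)), ?_⟩
  intro σ hσ hσlt T ρ θ u hsol Φ hLLN t ht
  have hσ₁' : σ < σ₁ := hσlt.trans_le ((min_le_left _ _).trans (min_le_left _ _))
  have hσ₂' : σ < σ₂ := hσlt.trans_le ((min_le_left _ _).trans (min_le_right _ _))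
  have hσ₃' : σ < σ₃ := hσlt.trans_le ((min_le_right _ _).trans (min_le_left _ _))
  have hσ8 : σ ≤ 1 / 8 := (hσlt.trans_le ((min_le_right _ _).trans (min_le_right _ _))).le
  obtain ⟨V₂, hV₂, hNF⟩ := hNF σ hσ hσ₂' T ρ θ u hsol Φ hLLN t ht
  obtain ⟨V₃, hV₃, hCR⟩ := hCR σ hσ hσ₃' T ρ θ u hsol Φ hLLN t ht
  have hE := hE σ hσ hσ₁'
  -- constants of the tail algebra
  set C' : ℝ := max C 1 with hC'
  have hC'0 : 0 < C' := one_pos.trans_le (le_max_right _ _)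
  have h3C' : 0 < 3 * C' := by positivity
  refine ⟨3 * C' * max V₂ V₃, by positivity, ?_⟩
  intro V hV e he
  -- reduced level and accuracy
  set V' : ℝ := V / (3 * C') with hV'
  set e' : ℝ := e / (9 * C') with he'
  have hV'₂ : V₂ ≤ V' := by
    rw [hV', le_div_iff₀' h3C']
    exact (mul_le_mul_of_nonneg_left (le_max_left V₂ V₃) h3C'.le).trans hV
  have hV'₃ : V₃ ≤ V' := by
    rw [hV', le_div_iff₀' h3C']
    exact (mul_le_mul_of_nonneg_left (le_max_right V₂ V₃) h3C'.le).trans hV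
  have hV'0 : 0 < V' := hV₂.trans_le hV'₂
  have he'0 : 0 < e' := by positivity
  obtain ⟨τ₁, hτ₁, hE⟩ := hE V' hV'0 e' he'0
  obtain ⟨τ₂, hτ₂, hNF⟩ := hNF V' hV'₂ e' he'0
  obtain ⟨τ₃, hτ₃, hCR⟩ := hCR V' hV'₃ e' he'0
  refine ⟨max τ₁ (max τ₂ τ₃), lt_max_of_lt_left hτ₁, ?_⟩
  intro τ hτ
  have hτ₁' : τ₁ ≤ τ := (le_max_left _ _).trans hτ
  have hτ₂' : τ₂ ≤ τ := ((le_max_left _ _).trans (le_max_right _ _)).trans hτ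
  have hτ₃' : τ₃ ≤ τ := ((le_max_right _ _).trans (le_max_right _ _)).trans hτ
  have hτ0 : 0 < τ := hτ₁.trans_le hτ₁'
  obtain ⟨N₂, hNF⟩ := hNF τ hτ₂'
  obtain ⟨N₃, hCR⟩ := hCR τ hτ₃'
  refine ⟨max N₂ N₃, ?_⟩
  intro N hN s hs
  obtain ⟨hmE, hiE⟩ := hE τ hτ₁' N (Φ N) s
  obtain ⟨hmNF, hiNF⟩ := hNF N ((le_max_left _ _).trans hN) s hs
  have hiCR := hCR N ((le_max_right _ _).trans hN) s hs
  -- the three averaged tails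
  set P := localGibbsLaw σ a₀ u₀ θ₀ N (Φ N) with hP
  set A₁ : Cfg N → ℝ := fun z =>
    ((N : ℝ) + 1)⁻¹ * ∑ i : Fin (N + 1), tailFn V' (endpointTerm (Φ N) τ s i z) with hA₁
  set A₂ : Cfg N → ℝ := fun z =>
    ((N : ℝ) + 1)⁻¹ * ∑ i : Fin (N + 1), tailFn V' (nearFieldKinetic (Φ N) τ s i z) with hA₂
  set A₃ : Cfg N → ℝ := fun z =>
    ((N : ℝ) + 1)⁻¹ * ∑ i : Fin (N + 1), tailFn V' (crowdedActivity (Φ N) τ s i z) with hA₃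
  have hmA₁ : AEMeasurable A₁ P := hmE.const_mul _
  have hmA₂ : AEMeasurable A₂ P := hmNF.const_mul _
  -- pointwise on the good set
  have hpt : ∀ z ∈ (Φ N).good,
      ((N : ℝ) + 1)⁻¹ * ∑ i : Fin (N + 1), tailFn V (act (Φ N) τ s i z) ≤ 3 * C' * (A₁ z + A₂ z + A₃ z) := by
    intro z hz
    have hsum : ∑ i : Fin (N + 1), tailFn V (act (Φ N) τ s i z) ≤
        ∑ i : Fin (N + 1), 3 * C' * (tailFn V' (endpointTerm (Φ N) τ s i z) +
          tailFn V' (nearFieldKinetic (Φ N) τ s i z) + tailFn V' (crowdedActivity (Φ N) τ s i z)) := by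
      refine Finset.sum_le_sum fun i _ => ?_
      have hF₁ : 0 ≤ endpointTerm (Φ N) τ s i z := by
        unfold endpointTerm relMomentumNear
        refine mul_nonneg (div_nonneg hσ.le hτ0.le) (add_nonneg ?_ ?_) <;>
          exact Finset.sum_nonneg fun j _ => by split_ifs <;> positivity
      exact tailFn_act_le hF₁ (nearFieldKinetic_nonneg (Φ N) hτ0 s i z)
        (crowdedActivity_nonneg hσ.le (Φ N) hτ0.le s i z) (hdom σ hσ hσ8 N (Φ N) τ hτ0 s z hz i)
    have hN1 : (0 : ℝ) ≤ ((N : ℝ) + 1)⁻¹ := by positivity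
    calc ((N : ℝ) + 1)⁻¹ * ∑ i : Fin (N + 1), tailFn V (act (Φ N) τ s i z)
        ≤ ((N : ℝ) + 1)⁻¹ * ∑ i : Fin (N + 1), 3 * C' * (tailFn V' (endpointTerm (Φ N) τ s i z) +
          tailFn V' (nearFieldKinetic (Φ N) τ s i z) + tailFn V' (crowdedActivity (Φ N) τ s i z)) :=
          mul_le_mul_of_nonneg_left hsum hN1
      _ = 3 * C' * (A₁ z + A₂ z + A₃ z) := by
          simp only [hA₁, hA₂, hA₃, ← Finset.mul_sum, Finset.sum_add_distrib]
          all_goals ring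
  have hae : ∀ᵐ z ∂P, ((N : ℝ) + 1)⁻¹ * ∑ i : Fin (N + 1), tailFn V (act (Φ N) τ s i z) ≤
      3 * C' * (A₁ z + A₂ z + A₃ z) := by
    filter_upwards [ae_mem_good_localGibbsLaw σ a₀ θ₀ u₀ N (Φ N)] with z hz using hpt z hz
  -- integrate
  have hbound : ∫⁻ z, ENNReal.ofReal (((N : ℝ) + 1)⁻¹ * ∑ i : Fin (N + 1), tailFn V (act (Φ N) τ s i z)) ∂P ≤
      ENNReal.ofReal e := by
    calc ∫⁻ z, ENNReal.ofReal (((N : ℝ) + 1)⁻¹ * ∑ i : Fin (N + 1), tailFn V (act (Φ N) τ s i z)) ∂P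
        ≤ ∫⁻ z, ENNReal.ofReal (3 * C' * (A₁ z + A₂ z + A₃ z)) ∂P :=
          lintegral_mono_ae (hae.mono fun z hz => ENNReal.ofReal_le_ofReal hz)
      _ ≤ ENNReal.ofReal (3 * C') * (∫⁻ z, ENNReal.ofReal (A₁ z) ∂P + ∫⁻ z, ENNReal.ofReal (A₂ z) ∂P +
          ∫⁻ z, ENNReal.ofReal (A₃ z) ∂P) := lintegral_ofReal_mul_add_three_le h3C'.le hmA₁ hmA₂
      _ ≤ ENNReal.ofReal (3 * C') * (ENNReal.ofReal e' + ENNReal.ofReal e' + ENNReal.ofReal e') := by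
          exact mul_le_mul_right (add_le_add (add_le_add hiE hiNF) hiCR) _
      _ = ENNReal.ofReal e := by
          rw [← ENNReal.ofReal_add he'0.le he'0.le, ← ENNReal.ofReal_add (by positivity) he'0.le,
            ← ENNReal.ofReal_mul h3C'.le]
          congr 1
          have hC'ne : C' ≠ 0 := hC'0.ne'
          rw [he']
          field_simp
          ring
  exact hbound

/-- **`CollisionActivityTails_of`** — the line's composition closes the crux BY NAME (route OneFlightGossipEngine's
copy of the decl) from the six registered stubs (four landed, two open). -/
theorem CollisionActivityTails_of :
    Summit.AtomisticToContinuum.HydrodynamicLimit.Theses.OneFlightGossipEngine.CollisionActivityTails :=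
  collisionActivityTails_of_stubs stub_activityDomination (stub_endpointTails stub_endpointKinematics
    stub_meanEnergyBound) stub_nearFieldKineticTails stub_crowdedCollisionTails

/-- **`CollisionActivityTails_proof`** — the same for the REGISTERED crux decl (route TwoClocks' copy; the two bodies
are byte-identical, so this is `CollisionActivityTails_of` by definitional unfolding). -/
theorem CollisionActivityTails_proof :
    Summit.AtomisticToContinuum.HydrodynamicLimit.Theses.TwoClocks.CollisionActivityTails :=
  CollisionActivityTails_of

end Summit.AtomisticToContinuum.HydrodynamicLimit.Theorems.CollisionActivityTails

end
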